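import Summits.FinalStateConjecture.FinalStateConjecture.Theses.SwallowTheDatum
import Summits.FinalStateConjecture.FinalStateConjecture.Theorems.SwallowTheDatumKerrShieldedDataExistStubSliceClause
import Summits.FinalStateConjecture.FinalStateConjecture.Theorems.SwallowTheDatumKerrShieldedDataExistStubIsotropicEnd
import Summits.FinalStateConjecture.FinalStateConjecture.Theorems.SwallowTheDatumKerrShieldedDataExistStubRicciFlatKS
import Summits.FinalStateConjecture.FinalStateConjecture.Theorems.SwallowTheDatumKerrShieldedDataExistStubInducedVacuumData
import Summits.FinalStateConjecture.FinalStateConjecture.Theorems.SwallowTheDatumKerrShieldedDataExistStubBridgeAnnulus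
import Summits.FinalStateConjecture.FinalStateConjecture.Theorems.SwallowTheDatumKerrShieldedDataExistStubAssembly
import Literature.Geometry.Lorentzian.AsymptoticallyFlatCompleteness
import HarnessLib

/-!
# Route SwallowTheDatum — crux `KerrShieldedDataExist` (stmt-FinalStateConjecture-10055) reduced to PlugData

Line `plug-the-second-sheet` (crux dir `Cruxes/KerrShieldedDataExist/Lines/plug_the_second_sheet.lean`), lead
prover-line-stmt-FinalStateConjecture-10055-0, 2026-08-16. This file makes the line's REDUCTION durable: the crux
`Summit.FinalStateConjecture.FinalStateConjecture.Theses.SwallowTheDatum.KerrShieldedDataExist` (one admissible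
vacuum datum on `E3` that is, outside a compact set, the hard-coded bent Kerr–Schild/Boyer–Lindquist leaf of a
sub-extremal Kerr down to a junction inside the horizon) FOLLOWS from the single remaining hypothesis

  PlugData: there are a mass `M > 0`, a depth `0 < ρ₃ < M/40` and a smooth datum `D₀` on `E3` solving the vacuum
  constraints which is EXACTLY time-symmetric isotropic Schwarzschild `((1 + M/2ρ)⁴ δ, 0)` on `{ρ > ρ₃}`
  (exact on the end, through the Einstein–Rosen throat `ρ = M/2` and on a sheet-2 collar; the second end replaced
  by a regular vacuum 3-ball — a time-symmetric "bag of gold").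

Everything else is PROVED in the tree (all at `a = 0`, no Einstein evolution): the slice clause of the crux's
pinned immersion with a smooth future unit normal (`stub_sliceClause`, on the landed certificate
`Negative.conormalForm_bentSlope_neg`), Ricci-flatness of Kerr–Schild Schwarzschild (`stub_ricciFlatKS`,
`Kerr.ricci_smoothMetric_zero_spin`), the packaging of induced data of spacelike immersions of chart domains
into vacuum `InitialDataSet`s (`stub_inducedVacuumData`, `Literature/…/InducedVacuumData.lean`), the BRIDGE
(`stub_bridgeAnnulus`: one spherically symmetric spacelike immersion of the annulus `{M/40 < s < 3M/4}` into the left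
ingoing chart of Kruskal — Boyer–Lindquist leaf of the left exterior read through the sheet-2 isotropic map, the
left Kerr–Schild slice through the left horizon, a rounded corner in the black-hole region, and the graph
`t*_L = 4M log(1 − r/2M)` = the right slice `{t*_R = 0}`), the ASSEMBLY on `E3` (`stub_assembly`: plug | bridge |
Kerr–Schild zone | bent leaf pushed forward along a radial profile that is the identity near the junction and the
sheet-1 isotropic radius beyond `8M`; the crux block holds by construction), the sole Dafermos–Rodnianski end of an
exactly isotropic far region (`stub_isotropicEnd`) and completeness (`isComplete_of_isSoleEnd_holds`).

PlugData itself is NOT in print verbatim (lead's reading, 2026-08-16): nearest are Chruściel–Delay, CQG 19 (2002)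
L71 = gr-qc/0203053, §4 ("many Schwarzschild": exact Schwarzschild near infinity and near each puncture, FLAT core,
`2N + 1 ≥ 3` ends) and §5 (local insertion of an exact Schwarzschild puncture at a parity-symmetric point — sign of the
mass left OPEN by the authors), Chruściel–Delay, Mém. SMF 94 (2003) = gr-qc/0301073, Thm 5.9/Cor 5.11 and §8.9
(projected local deformation; "many Kerr"), Thm 8.15/Rem 8.18 (localised IMP gluing keeps the KID-FREE side exact,
not the Schwarzschild side), Corvino, CMP 214 (2000) (exactness at infinity only), Beig–Ó Murchadha, PRL 66 (1991)
2421 (critical sequences: caps with large positive mass, exact nowhere). A proof of PlugData is a NEW COMBINATION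
(cap engine + Chruściel–Delay projected gluing on a Schwarzschild annulus with the 1-dimensional static cokernel
`span{N}` killed by the mass, IVT) — crux-sized; see the crux directory's `NOTES.md`.
-/

set_option linter.dupNamespace false

noncomputable section

open Set Function Filter Topology
open scoped Manifold ContDiff Topology InnerProductSpace
open Literature.Geometry.Lorentzian
open Summit.FinalStateConjecture.FinalStateConjecture.Theorems.KerrShieldedDataExist

namespace Summit.FinalStateConjecture.FinalStateConjecture.Theorems.SwallowTheDatum

/-- **The crux `KerrShieldedDataExist` from PlugData** (the composition of line `plug-the-second-sheet`, all of
whose geometric obligations are theorems of the tree): given a mass `M > 0`, a depth `0 < ρ₃ < M/40` and a smooth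
vacuum datum `D₀` on `E3` which is exactly `((1 + M/2ρ)⁴ δ, 0)` on `{ρ > ρ₃}`, there is an admissible vacuum datum
on `E3` satisfying the crux's shielding block (with `a = 0`, junction radius `r₁ = M`, the literal bent height,
the pinned graph and its future unit normal). Logical shape: slice clause at `r₁ := M` → bridge (fed with
Ricci-flatness and the induced-data packaging) → assembly → isotropic end → completeness
(`isComplete_of_isSoleEnd_holds`, Gordon's criterion) → `admissibleVacuumData` → the crux decl by name.
[cite: LiMei2020, §2.2] [cite: ONeill1983, Ch. 13] [cite: Christodoulou1999, p. A24] -/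
theorem kerrShieldedDataExist_of_plugData :
    (∃ (M ρ₃ : ℝ) (D₀ : InitialDataSet (𝓡 3) E3), 0 < M ∧ 0 < ρ₃ ∧ ρ₃ < M / 40 ∧ (∀ [D₀.metric.HasLeviCivita], D₀.IsVacuumConstraintSolution) ∧ (∀ y : E3, ρ₃ < ‖y‖ → (∀ v w : E3, D₀.h.inner y v w = Schwarzschild.conformalFactor M y ^ 4 * ⟪v, w⟫_ℝ) ∧ D₀.k y = 0)) → Summit.FinalStateConjecture.FinalStateConjecture.Theses.SwallowTheDatum.KerrShieldedDataExist := by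
  intro hplug inst
  obtain ⟨M, ρ₃, D₀, hMpos, hρ₃, hρ₃M, hvac₀, hexact₀⟩ := hplug
  have h34 : 3 * M / 4 < M := by linarith
  have h2M : M < 2 * M := by linarith
  obtain ⟨hT, hsp, N₀, hN₀, hν⟩ := @Summit.FinalStateConjecture.FinalStateConjecture.Theorems.SwallowTheDatum.stub_sliceClause _ M M hMpos.le hMpos hMpos
  have hRic := fun r₀ ↦ @Summit.FinalStateConjecture.FinalStateConjecture.Theorems.SwallowTheDatum.stub_ricciFlatKS _ M r₀
  have hInd := fun r₀ ↦ @Summit.FinalStateConjecture.FinalStateConjecture.Theorems.SwallowTheDatum.stub_inducedVacuumData _ M r₀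
  have hBr := @Summit.FinalStateConjecture.FinalStateConjecture.Theorems.SwallowTheDatum.stub_bridgeAnnulus _ M hMpos hRic hInd hT
  obtain ⟨D, hvac, ⟨R, hR, hfar⟩, hblock⟩ :=
    @Summit.FinalStateConjecture.FinalStateConjecture.Theorems.SwallowTheDatum.stub_assembly _ M ρ₃ D₀ hMpos.le hMpos hρ₃ hρ₃M @hvac₀ hexact₀ hRic hInd hT hBr
      M h34 h2M hsp N₀ hN₀ hν
  obtain ⟨e, hsole, hDR⟩ := Summit.FinalStateConjecture.FinalStateConjecture.Theorems.SwallowTheDatum.stub_isotropicEnd D M R hMpos.le hR hfar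
  have hadm : D ∈ admissibleVacuumData E3 := by
    refine mem_admissibleVacuumData_iff.mpr ⟨?_, e, M, hsole, hDR⟩
    intro hLC
    exact ⟨hvac, isComplete_of_isSoleEnd_holds E3 D e M 1 2 2 1 zero_le_one hDR hsole⟩
  exact ⟨D, hadm, M, hblock⟩

end Summit.FinalStateConjecture.FinalStateConjecture.Theorems.SwallowTheDatum

end
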